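import Mathlib

/-!
# The one-leg conditioning law (quantitative `δ = 1/2` regime of `stub_nonnegFlatDecay`)

Line `unit-tensor-orbit-nuclear-ratio` for the crux `FidelityWitnesses.DiagonalPowerDecay`
(`stmt-MatrixMultiplication-14053`), open stub `stub_nonnegFlatDecay`:
`|⟨S, Y⟩|² ≤ C·|ι|^{3/2-δ}·‖S‖²` for flat non-negative `Y` and orbit points
`S = Σ_l g₁(·,l) ⊗ g₂(·,l) ⊗ g₃(·,l)`.

`oneLegOrthonormalLaw` (Theorems/…OneLegOrthonormal.lean, p99776) settles the case of an orthonormal first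
leg. This file (self-contained) makes it QUANTITATIVE (`oneLegConditionedLaw`, registered sub-goal): if the Gram matrix of ONE
leg is pinched between `m > 0` and `M` — lower Rayleigh bound `m·Σ_l |z_l|² ≤ ‖Σ_l z_l g₁(·,l)‖²` for all
coefficient vectors `z`, and column norms `‖g₁(·,l)‖² ≤ M` — then for every flat `Y`
`|⟨S, Y⟩|² ≤ (M/m) · |ι| · ‖S‖²`.
Consequence for the stub: a frame can violate the bound `C·|ι|^{3/2-δ}·‖S‖²` only if EACH of its three legs
has Gram condition ratio `M/m > C·|ι|^{1/2-δ}` — the difficulty is localised on frames that are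
simultaneously ill-conditioned in all three legs by a POWER of `|ι|` (coherent cancelling frames).
-/

-- the tree's namespace `Summit.MatrixMultiplication.MatrixMultiplication.…` repeats a component by design
set_option linter.dupNamespace false

namespace Summit.MatrixMultiplication.MatrixMultiplication.Theorems.DiagonalPowerDecay

open scoped BigOperators ComplexConjugate

noncomputable section

/-- The overlap of a frame tensor with `Y` is the sum of the triad overlaps (linearity in the frame index). -/
theorem condLeg_overlap_sum {ι : Type} [Fintype ι] (g₁ g₂ g₃ : Matrix ι ι ℂ) (Y : ι → ι → ι → ℂ) :
    (∑ a, ∑ b, ∑ c, (∑ l, g₁ a l * g₂ b l * g₃ c l) * Y a b c) =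
      ∑ l, ∑ a, ∑ b, ∑ c, g₁ a l * g₂ b l * g₃ c l * Y a b c := by
  simp only [Finset.sum_mul]
  calc (∑ a, ∑ b, ∑ c, ∑ l, g₁ a l * g₂ b l * g₃ c l * Y a b c)
      = ∑ a, ∑ b, ∑ l, ∑ c, g₁ a l * g₂ b l * g₃ c l * Y a b c :=
        Finset.sum_congr rfl fun a _ => Finset.sum_congr rfl fun b _ => Finset.sum_comm
    _ = ∑ a, ∑ l, ∑ b, ∑ c, g₁ a l * g₂ b l * g₃ c l * Y a b c :=
        Finset.sum_congr rfl fun a _ => Finset.sum_comm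
    _ = ∑ l, ∑ a, ∑ b, ∑ c, g₁ a l * g₂ b l * g₃ c l * Y a b c := Finset.sum_comm

/-- **The one-leg conditioning law** (registered sub-goal `oneLegConditionedLaw` of crux
`stmt-MatrixMultiplication-14053`, line `unit-tensor-orbit-nuclear-ratio`): for a spectrally flat `Y` and a
frame `S = Σ_l g₁(·,l) ⊗ g₂(·,l) ⊗ g₃(·,l)` whose first leg satisfies `m·Σ|z_l|² ≤ ‖Σ_l z_l g₁(·,l)‖²`
(`m > 0`) and `‖g₁(·,l)‖² ≤ M`, one has `|⟨S, Y⟩|² ≤ (M/m)·|ι|·‖S‖²`. -/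
theorem oneLegConditionedLaw :
    ∀ (ι : Type) [Fintype ι] [DecidableEq ι] (Y : ι → ι → ι → ℂ),
      (∀ w u v : ι → ℂ, ‖∑ a, ∑ b, ∑ c, w a * u b * v c * Y a b c‖ ≤
          Real.sqrt (∑ a, ‖w a‖ ^ 2) * Real.sqrt (∑ b, ‖u b‖ ^ 2) * Real.sqrt (∑ c, ‖v c‖ ^ 2)) →
      ∀ (m M : ℝ) (g₁ g₂ g₃ : Matrix ι ι ℂ), 0 < m →
        (∀ z : ι → ℂ, m * ∑ l, ‖z l‖ ^ 2 ≤ ∑ a, ‖∑ l, g₁ a l * z l‖ ^ 2) →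
        (∀ l : ι, (∑ a, ‖g₁ a l‖ ^ 2) ≤ M) →
        ‖∑ a, ∑ b, ∑ c, (∑ l, g₁ a l * g₂ b l * g₃ c l) * Y a b c‖ ^ 2 ≤
          M / m * (Fintype.card ι : ℝ) * ∑ a, ∑ b, ∑ c, ‖∑ l, g₁ a l * g₂ b l * g₃ c l‖ ^ 2 := by
  intro ι _ _ Y hY m M g₁ g₂ g₃ hm hlow hup
  set B : ι → ℝ := fun l => Real.sqrt (∑ b, ‖g₂ b l‖ ^ 2) with hB
  set Cc : ι → ℝ := fun l => Real.sqrt (∑ c, ‖g₃ c l‖ ^ 2) with hCc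
  -- empty format: every sum vanishes
  rcases isEmpty_or_nonempty ι with hι | ⟨⟨l₀⟩⟩
  · simp
  have hM0 : 0 ≤ M := (Finset.sum_nonneg fun a _ => sq_nonneg ‖g₁ a l₀‖).trans (hup l₀)
  -- Step 1: `|⟨S,Y⟩| ≤ √M · Σ_l B_l C_l`
  have step1 : ‖∑ a, ∑ b, ∑ c, (∑ l, g₁ a l * g₂ b l * g₃ c l) * Y a b c‖ ≤
      Real.sqrt M * ∑ l, B l * Cc l := by
    rw [condLeg_overlap_sum, Finset.mul_sum]
    refine (norm_sum_le _ _).trans (Finset.sum_le_sum fun l _ => ?_)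
    have h := hY (fun a => g₁ a l) (fun b => g₂ b l) (fun c => g₃ c l)
    refine h.trans ?_
    have hcol : Real.sqrt (∑ a, ‖g₁ a l‖ ^ 2) ≤ Real.sqrt M := Real.sqrt_le_sqrt (hup l)
    calc Real.sqrt (∑ a, ‖g₁ a l‖ ^ 2) * B l * Cc l
        ≤ Real.sqrt M * B l * Cc l := by gcongr
      _ = Real.sqrt M * (B l * Cc l) := by ring
  -- Step 2: Cauchy–Schwarz over `l`
  have step2 : (∑ l, B l * Cc l) ^ 2 ≤ (Fintype.card ι : ℝ) * ∑ l, (B l * Cc l) ^ 2 := by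
    have h := Finset.sum_mul_sq_le_sq_mul_sq Finset.univ (fun _ : ι => (1 : ℝ)) (fun l => B l * Cc l)
    simp only [one_mul, one_pow, Finset.sum_const, Finset.card_univ, nsmul_eq_mul, mul_one] at h
    exact h
  -- Step 3: `m · Σ_l (B_l C_l)² ≤ ‖S‖²` (lower Rayleigh bound in the first slot, for fixed `(b, c)`)
  have step3 : m * (∑ l, (B l * Cc l) ^ 2) ≤ ∑ a, ∑ b, ∑ c, ‖∑ l, g₁ a l * g₂ b l * g₃ c l‖ ^ 2 := by
    have e : (∑ l, (B l * Cc l) ^ 2) = ∑ b, ∑ c, ∑ l, ‖g₂ b l * g₃ c l‖ ^ 2 := by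
      calc (∑ l, (B l * Cc l) ^ 2) = ∑ l, (∑ b, ‖g₂ b l‖ ^ 2) * ∑ c, ‖g₃ c l‖ ^ 2 := by
            refine Finset.sum_congr rfl fun l _ => ?_
            rw [mul_pow, hB, hCc, Real.sq_sqrt (by positivity), Real.sq_sqrt (by positivity)]
        _ = ∑ l, ∑ b, ∑ c, ‖g₂ b l * g₃ c l‖ ^ 2 := by
            refine Finset.sum_congr rfl fun l _ => ?_
            rw [Finset.sum_mul_sum]
            exact Finset.sum_congr rfl fun b _ => Finset.sum_congr rfl fun c _ => by
              rw [norm_mul, mul_pow]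
        _ = ∑ b, ∑ l, ∑ c, ‖g₂ b l * g₃ c l‖ ^ 2 := Finset.sum_comm
        _ = ∑ b, ∑ c, ∑ l, ‖g₂ b l * g₃ c l‖ ^ 2 := Finset.sum_congr rfl fun b _ => Finset.sum_comm
    rw [e, Finset.mul_sum]
    calc (∑ b, m * ∑ c, ∑ l, ‖g₂ b l * g₃ c l‖ ^ 2)
        = ∑ b, ∑ c, m * ∑ l, ‖g₂ b l * g₃ c l‖ ^ 2 := by
          refine Finset.sum_congr rfl fun b _ => ?_
          rw [Finset.mul_sum]
      _ ≤ ∑ b, ∑ c, ∑ a, ‖∑ l, g₁ a l * (g₂ b l * g₃ c l)‖ ^ 2 :=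
          Finset.sum_le_sum fun b _ => Finset.sum_le_sum fun c _ => hlow (fun l => g₂ b l * g₃ c l)
      _ = ∑ b, ∑ a, ∑ c, ‖∑ l, g₁ a l * (g₂ b l * g₃ c l)‖ ^ 2 :=
          Finset.sum_congr rfl fun b _ => Finset.sum_comm
      _ = ∑ a, ∑ b, ∑ c, ‖∑ l, g₁ a l * (g₂ b l * g₃ c l)‖ ^ 2 := Finset.sum_comm
      _ = ∑ a, ∑ b, ∑ c, ‖∑ l, g₁ a l * g₂ b l * g₃ c l‖ ^ 2 := by
          simp only [mul_assoc]
  -- assemble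
  calc ‖∑ a, ∑ b, ∑ c, (∑ l, g₁ a l * g₂ b l * g₃ c l) * Y a b c‖ ^ 2
      ≤ (Real.sqrt M * ∑ l, B l * Cc l) ^ 2 := pow_le_pow_left₀ (norm_nonneg _) step1 2
    _ = M * (∑ l, B l * Cc l) ^ 2 := by rw [mul_pow, Real.sq_sqrt hM0]
    _ ≤ M * ((Fintype.card ι : ℝ) * ∑ l, (B l * Cc l) ^ 2) := mul_le_mul_of_nonneg_left step2 hM0
    _ = M / m * (Fintype.card ι : ℝ) * (m * ∑ l, (B l * Cc l) ^ 2) := by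
          rw [div_mul_eq_mul_div, div_mul_eq_mul_div, eq_div_iff hm.ne']
          ring
    _ ≤ M / m * (Fintype.card ι : ℝ) * ∑ a, ∑ b, ∑ c, ‖∑ l, g₁ a l * g₂ b l * g₃ c l‖ ^ 2 := by
          have hk : 0 ≤ M / m * (Fintype.card ι : ℝ) :=
            mul_nonneg (div_nonneg hM0 hm.le) (Nat.cast_nonneg _)
          exact mul_le_mul_of_nonneg_left step3 hk

end

end Summit.MatrixMultiplication.MatrixMultiplication.Theorems.DiagonalPowerDecay
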